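import Mathlib
import HarnessLib
import Literature.MathematicalPhysics.StatisticalMechanics.TorusDiscreteLeibniz
import Literature.MathematicalPhysics.StatisticalMechanics.WeightTowerFactorisation
import Literature.MathematicalPhysics.StatisticalMechanics.HigherDerivativeForms
import Literature.MathematicalPhysics.StatisticalMechanics.WeightDataGeometry
import Literature.Analysis.Matrix.RegulatorSubcriticality

/-!
# The trace bound behind Theorem 7.1 (w7): `tr(𝒞^{1/2} A_k^X 𝒞^{1/2}) ≤ c · #supp(χ) · L^{−kd}`
# (Adams–Buchholz–Kotecký–Müller, Lemma 7.7 (i), (7.73)–(7.78))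

The determinant estimate of [ABKM19] Lemma 7.7 (i) rests on a bound of the trace
`tr((𝒞_{k+1})^{1/2} A_k^X (𝒞_{k+1})^{1/2})` for a form `A_k^X` that is LOCAL (depends on the field
on `X^{++}` only) and dominated by the translation-invariant operator `λ⁻¹M_k`
(`M_k = Σ_{α} L^{2k(|α|−1)}(∇^α)*∇^α`, (7.72)).  The proof inserts a smooth cutoff `χ` with
`χ = 1` on the locality set (`m_χ A m_χ = A`, (7.74)), moves it onto the covariance by cyclicity,
and expands `M_k(m_χ 𝒞 m_χ)` by the discrete product rule ((7.75)–(7.78)).  This file proves the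
abstract statement on the torus `(ℤ/M)^d`:

* matrix steps: `diag_mul_mul_diag_eq_of_isGradLocal` ((7.74)), `trace_sqrt_mul_sqrt_eq_trace_mul`,
  `trace_mul_le_trace_mul_of_posSemidef` (`A ⪯ B`, `Q ⪰ 0 ⇒ tr(AQ) ≤ tr(BQ)`),
  `trace_transpose_mul_mul_eq_sum` (`tr((∇^α)ᵀ∇^α Q) = Σ_x ∇^α_y[∇^α_z Q(z,y)](x,x)`);
* the pointwise estimate `abs_iterDiff_iterDiff_kernel_le` — for `|∇^βχ| ≤ p^{|β|}` and
  `|∇^θ𝒞| ≤ C₀q^{|θ|}` (orders `≤ 2m`), every diagonal term is `≤ C₀(p+q)^{2|α|}` (`|α| ≤ m`), and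
  vanishes unless `χ ≠ 0` somewhere on the stencil `x + [0,α]`;
* **`trace_sqrt_mul_sqrt_le_of_isGradLocal`** — for symmetric `A`, `IsGradLocal A S`, `χ = 1` on
  `S`, `A ⪯ c₀·Σ_{α∈s}L^{2k(|α|−1)}(∇^α)ᵀ∇^α`, `𝒞` with `circulant 𝒞 ⪰ 0`:
  `tr(√C A √C) ≤ c₀ · #(supp χ + [−m,m]^d) · C₀ · Σ_{α∈s} L^{2k(|α|−1)}(p+q)^{2|α|}`.

With `p, q = O(L^{−k})` and `C₀ = O(L^{−k(d−2)})` (finite-range decomposition bounds (7.77)) every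
summand is `O(L^{−kd})`, giving `c|X|_k` for a cutoff supported in `O(L^{kd}|X|_k)` points.

Everything is proved; no named fact.

## References
* S. Adams, S. Buchholz, R. Kotecký, S. Müller, arXiv:1910.13564, Lemma 7.7 (i), (7.72)–(7.78)
  [AdamsBuchholzKoteckyMuller2019].
-/

noncomputable section

namespace Literature.MathematicalPhysics.StatisticalMechanics.GradientRG

open Finset Matrix
open scoped MatrixOrder
open Literature.MathematicalPhysics.StatisticalMechanics.GradientFRD (iterDiff supNorm)
open Literature.MathematicalPhysics.StatisticalMechanics.TorusPolymer (ball thicken mem_ball mem_thicken)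
open Literature.Analysis.Matrix (posSemidef_cfcSqrt conjTranspose_cfcSqrt)

variable {d M : ℕ} [NeZero M]

/-! ## Matrix steps -/

/-- **`m_χ A m_χ = A`** for a symmetric form local on `S` and a cutoff `χ = 1` on `S` ((7.74): "because
`A_k^X` is self adjoint and depends only on `φ(x)` for `x ∈ X^{++}`").
[cite: AdamsBuchholzKoteckyMuller2019, Lemma 7.7 (i) (7.74)] -/
theorem diag_mul_mul_diag_eq_of_isGradLocal {A : Matrix (Fin d → ZMod M) (Fin d → ZMod M) ℝ}
    {S : Finset (Fin d → ZMod M)} (hA : IsGradLocal A S) (hAs : A.IsSymm) {χ : (Fin d → ZMod M) → ℝ}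
    (hχ : ∀ x ∈ S, χ x = 1) : Matrix.diagonal χ * A * Matrix.diagonal χ = A := by
  -- entries of `A` vanish unless both indices lie in `S`
  have hcol : ∀ x y, y ∉ S → A x y = 0 := fun x y hy => by
    have h := hA.mulVec_eq_zero_of_forall_mem (φ := Pi.single y (1 : ℝ)) fun z hz => by
      rw [Pi.single_apply, if_neg]; rintro rfl; exact hy hz
    have := congrFun h x
    simpa [Matrix.mulVec, dotProduct, Pi.single_apply] using this
  have hrow : ∀ x y, x ∉ S → A x y = 0 := fun x y hx => by
    have hAt : Aᵀ = A := hAs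
    rw [← hAt, Matrix.transpose_apply]; exact hcol y x hx
  ext x y
  rw [Matrix.mul_apply]
  simp only [Matrix.diagonal_mul]
  rw [Finset.sum_eq_single y (fun z _ hzy => by rw [Matrix.diagonal_apply_ne _ hzy, mul_zero])
    (fun h => (h (mem_univ y)).elim), Matrix.diagonal_apply_eq]
  by_cases hx : x ∈ S
  · by_cases hy : y ∈ S
    · rw [hχ x hx, hχ y hy, one_mul, mul_one]
    · rw [hcol x y hy, mul_zero, zero_mul]
  · rw [hrow x y hx, mul_zero, zero_mul]

/-- `tr(√C A √C) = tr(A C)` for `C ⪰ 0`. [cite: AdamsBuchholzKoteckyMuller2019, Lemma 7.7 (i) (7.72)] -/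
theorem trace_sqrt_mul_sqrt_eq_trace_mul {A C : Matrix (Fin d → ZMod M) (Fin d → ZMod M) ℝ}
    (hC : C.PosSemidef) : (CFC.sqrt C * A * CFC.sqrt C).trace = (A * C).trace := by
  rw [Matrix.mul_assoc, Matrix.trace_mul_comm, Matrix.mul_assoc, CFC.sqrt_mul_sqrt_self C hC.nonneg]

/-- **Monotonicity of `A ↦ tr(AQ)` for `Q ⪰ 0`**: `A ⪯ B ⇒ tr(AQ) ≤ tr(BQ)` ("for symmetric
operators, the inequality `A ≥ B` implies `Tr A ≥ Tr B`", applied after conjugation, (7.72)).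
[cite: AdamsBuchholzKoteckyMuller2019, Lemma 7.7 (i) (7.72)] -/
theorem trace_mul_le_trace_mul_of_posSemidef {A B Q : Matrix (Fin d → ZMod M) (Fin d → ZMod M) ℝ}
    (hAB : (B - A).PosSemidef) (hQ : Q.PosSemidef) : (A * Q).trace ≤ (B * Q).trace := by
  rw [← trace_sqrt_mul_sqrt_eq_trace_mul hQ, ← trace_sqrt_mul_sqrt_eq_trace_mul hQ]
  exact WeightData.trace_sqrt_mul_sqrt_mono hAB

/-- A conjugate `D C D` of `C ⪰ 0` by a real diagonal matrix is `⪰ 0`.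
[cite: AdamsBuchholzKoteckyMuller2019, Lemma 7.7 (i) (7.72)] -/
theorem posSemidef_diag_mul_mul_diag {C : Matrix (Fin d → ZMod M) (Fin d → ZMod M) ℝ}
    (hC : C.PosSemidef) (χ : (Fin d → ZMod M) → ℝ) :
    (Matrix.diagonal χ * C * Matrix.diagonal χ).PosSemidef := by
  have h := hC.conjTranspose_mul_mul_same (Matrix.diagonal χ)
  rwa [Matrix.diagonal_conjTranspose, star_trivial] at h

/-- **`tr((∇^α)ᵀ∇^α Q) = Σ_x ∇^α_y[ y ↦ ∇^α_z[Q(z,y)](x) ](x)`** — the diagonal of `∇^α Q (∇^α)ᵀ` in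
terms of differences of the two-variable kernel of `Q`.
[cite: AdamsBuchholzKoteckyMuller2019, Lemma 7.7 (i) (7.74)] -/
theorem trace_transpose_mul_mul_eq_sum (α : Fin d → ℕ) (Q : Matrix (Fin d → ZMod M) (Fin d → ZMod M) ℝ) :
    ((iterDiffMat α)ᵀ * iterDiffMat α * Q).trace =
      ∑ x, iterDiff α (fun y => iterDiff α (fun z => Q z y) x) x := by
  rw [Matrix.mul_assoc, Matrix.trace_mul_comm, Matrix.trace]
  refine Finset.sum_congr rfl fun x _ => ?_
  rw [Matrix.diag_apply, Matrix.mul_apply]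
  -- `(T Q Tᵀ)_{xx} = Σ_y (TQ)_{xy} T_{xy} = (T *ᵥ (y ↦ (TQ)_{xy}))(x)`
  have h1 : ∀ y, ((iterDiffMat α : Matrix (Fin d → ZMod M) (Fin d → ZMod M) ℝ) * Q) x y =
      iterDiff α (fun z => Q z y) x := fun y => by
    have := congrFun (iterDiffMat_mulVec (M := M) α (fun z => Q z y)) x
    rw [← this, Matrix.mulVec, dotProduct, Matrix.mul_apply]
  have h2 := congrFun (iterDiffMat_mulVec (M := M) α (fun y => iterDiff α (fun z => Q z y) x)) x
  rw [← h2, Matrix.mulVec, dotProduct]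
  exact Finset.sum_congr rfl fun y _ => by rw [Matrix.transpose_apply, h1, mul_comm]

/-! ## The pointwise estimate -/

/-- The linear functional `u ↦ ∇^α(χ·u)(x)`. [cite: AdamsBuchholzKoteckyMuller2019, Lemma 7.7 (i) (7.75)] -/
def mulDiffEval (α : Fin d → ℕ) (χ : (Fin d → ZMod M) → ℝ) (x : Fin d → ZMod M) :
    ((Fin d → ZMod M) → ℝ) →ₗ[ℝ] ℝ where
  toFun u := iterDiff α (χ * u) x
  map_add' u v := by rw [mul_add, iterDiff_add, Pi.add_apply]
  map_smul' c u := by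
    rw [show χ * (c • u) = c • (χ * u) by funext z; simp [mul_left_comm], iterDiff_smul,
      Pi.smul_apply, smul_eq_mul, RingHom.id_apply, smul_eq_mul]

omit [NeZero M] in
/-- **The diagonal terms are `O((p+q)^{2|α|})`** ((7.76)–(7.78)): if `|∇^βχ| ≤ p^{|β|}` and
`|∇^θ𝒞| ≤ C₀ q^{|θ|}` for all orders `≤ 2m` and `|α| ≤ m`, then
`|∇^α_y[ χ(y)·∇^α_z[χ(z)𝒞(z − y)](x) ](x)| ≤ C₀ (p+q)^{2|α|}`.
[cite: AdamsBuchholzKoteckyMuller2019, Lemma 7.7 (i) (7.78)] -/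
theorem abs_iterDiff_iterDiff_kernel_le {χ 𝒞 : (Fin d → ZMod M) → ℝ} {p q C₀ : ℝ} {m : ℕ}
    (hχ : ∀ β : Fin d → ℕ, ∑ i, β i ≤ 2 * m → ∀ y, |iterDiff β χ y| ≤ p ^ (∑ i, β i))
    (h𝒞 : ∀ θ : Fin d → ℕ, ∑ i, θ i ≤ 2 * m → ∀ w, |iterDiff θ 𝒞 w| ≤ C₀ * q ^ (∑ i, θ i))
    {α : Fin d → ℕ} (hα : ∑ i, α i ≤ m) (x : Fin d → ZMod M) :
    |iterDiff α (fun y => χ y * iterDiff α (fun z => χ z * 𝒞 (z - y)) x) x| ≤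
      C₀ * (p + q) ^ (2 * ∑ i, α i) := by
  set n := ∑ i, α i with hn
  -- `G(y) = ∇^α_z[χ(z)𝒞(z−y)](x) = Z(reflected translate of 𝒞)`, `Z = mulDiffEval α χ x`
  set G : (Fin d → ZMod M) → ℝ := fun y => iterDiff α (fun z => χ z * 𝒞 (z - y)) x with hG
  have hGZ : G = fun y => mulDiffEval α χ x (fun z => 𝒞 (z - y)) := by
    funext y; rfl
  -- derivative bounds of `G` in `y`, with rate `q` and constant `C₀ (p+q)^n`
  have hGbnd : ∀ β : Fin d → ℕ, ∑ i, β i ≤ n → ∀ y,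
      |iterDiff β G y| ≤ C₀ * (p + q) ^ n * q ^ (∑ i, β i) := by
    intro β hβ y
    rw [hGZ, iterDiff_linear_family (mulDiffEval α χ x) (fun y z => 𝒞 (z - y)) β]
    -- `∇^β_y 𝒞(z − y) = (−1)^{|β|} (∇^β𝒞)(z − β − y)`
    have hrefl : (fun z => iterDiff β (fun y' => 𝒞 (z - y')) y) =
        fun z => (-1 : ℝ) ^ (∑ i, β i) * iterDiff β 𝒞 (z - natVec β - y) := by
      funext z
      have := congrFun (iterDiff_reflectFn β z 𝒞) y
      simp only [reflectFn, Pi.smul_apply, smul_eq_mul] at this ⊢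
      exact this
    change |mulDiffEval α χ x (fun z => iterDiff β (fun y' => 𝒞 (z - y')) y)| ≤ _
    rw [hrefl]
    change |iterDiff α (χ * fun z => (-1 : ℝ) ^ (∑ i, β i) * iterDiff β 𝒞 (z - natVec β - y)) x| ≤ _
    have hsm : (χ * fun z => (-1 : ℝ) ^ (∑ i, β i) * iterDiff β 𝒞 (z - natVec β - y)) =
        ((-1 : ℝ) ^ (∑ i, β i)) • (χ * shiftFn (-(natVec β + y)) (iterDiff β 𝒞)) := by
      funext z; simp only [Pi.mul_apply, Pi.smul_apply, shiftFn_apply, smul_eq_mul]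
      rw [show z + -(natVec β + y) = z - natVec β - y by abel]; ring
    rw [hsm, iterDiff_smul, Pi.smul_apply, smul_eq_mul, abs_mul, abs_pow, abs_neg, abs_one, one_pow,
      one_mul]
    -- Leibniz bound in `z` at order `n`: `χ` with `(1, p)`, the translate of `∇^β𝒞` with `(C₀q^{|β|}, q)`
    have := abs_iterDiff_mul_le (M := M) (p := p) (q := q) n 1 (C₀ * q ^ (∑ i, β i)) χ
      (shiftFn (-(natVec β + y)) (iterDiff β 𝒞)) (fun γ hγ w => by
        rw [one_mul]; exact hχ γ (by omega) w)
      (fun γ hγ w => by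
        rw [iterDiff_shiftFn, shiftFn_apply, iterDiff_iterDiff]
        refine (h𝒞 (γ + β) (by rw [Pi.add_def]; simp only [Finset.sum_add_distrib]; omega) _).trans ?_
        simp only [Pi.add_apply, Finset.sum_add_distrib, pow_add]
        ring_nf; exact le_rfl)
      α le_rfl x
    calc |iterDiff α (χ * shiftFn (-(natVec β + y)) (iterDiff β 𝒞)) x|
        ≤ 1 * (C₀ * q ^ (∑ i, β i)) * (p + q) ^ n := this
      _ = C₀ * (p + q) ^ n * q ^ (∑ i, β i) := by ring
  -- Leibniz bound in `y` at order `n`: `χ` with `(1, p)`, `G` with `(C₀(p+q)^n, q)`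
  have hmain := abs_iterDiff_mul_le (M := M) (p := p) (q := q) n 1 (C₀ * (p + q) ^ n) χ G
    (fun β hβ y => by rw [one_mul]; exact hχ β (by omega) y) hGbnd α le_rfl x
  have heq : (fun y => χ y * iterDiff α (fun z => χ z * 𝒞 (z - y)) x) = χ * G := by
    funext y; rfl
  rw [heq]
  calc |iterDiff α (χ * G) x| ≤ 1 * (C₀ * (p + q) ^ n) * (p + q) ^ n := hmain
    _ = C₀ * (p + q) ^ (2 * n) := by ring

/-- **The diagonal term at `x` vanishes unless `χ ≠ 0` on the stencil `x + [0,α]`**, in particular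
unless `x ∈ supp χ + [−|α|, |α|]^d`. [cite: AdamsBuchholzKoteckyMuller2019, Lemma 7.7 (i) (7.78)] -/
theorem iterDiff_iterDiff_kernel_eq_zero {χ 𝒞 : (Fin d → ZMod M) → ℝ} {α : Fin d → ℕ} {m : ℕ}
    (hα : ∑ i, α i ≤ m) {x : Fin d → ZMod M}
    (hx : x ∉ thicken m (univ.filter fun y => χ y ≠ 0)) :
    iterDiff α (fun y => χ y * iterDiff α (fun z => χ z * 𝒞 (z - y)) x) x = 0 := by
  refine iterDiff_apply_eq_zero α _ x fun β hβ => ?_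
  have hχ0 : χ (x + fun i => ((β i : ℕ) : ZMod M)) = 0 := by
    by_contra h
    refine hx (mem_thicken.2 ⟨x + fun i => ((β i : ℕ) : ZMod M), mem_filter.2 ⟨mem_univ _, h⟩, ?_⟩)
    rw [sub_add_cancel_left, GradientFRD.supNorm_neg]
    exact (supNorm_natCast_le β).trans ((Finset.sum_le_sum fun i _ => hβ i).trans hα)
  rw [hχ0, zero_mul]

/-! ## The trace bound -/

/-- **[ABKM19] Lemma 7.7 (i), trace form.**  Let `A` be symmetric and local on `S`
(`IsGradLocal A S`), `χ = 1` on `S` with `|∇^βχ| ≤ p^{|β|}` (`|β| ≤ 2m`), `A ⪯ c₀·M` with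
`M = Σ_{α∈s} L^{2k(|α|−1)}(∇^α)ᵀ∇^α` (`|α| ≤ m` on `s`, `c₀ ≥ 0`, `L ≥ 0`), and `𝒞` a kernel with
`circulant 𝒞 ⪰ 0` and `|∇^θ𝒞| ≤ C₀q^{|θ|}` (`|θ| ≤ 2m`).  Then
`tr(√C A √C) ≤ c₀ · #(supp χ + [−m,m]^d) · C₀ · Σ_{α∈s} L^{2k(|α|−1)} (p+q)^{2|α|}`, `C = circulant 𝒞`.
[cite: AdamsBuchholzKoteckyMuller2019, Lemma 7.7 (i) (7.78)] -/
theorem trace_sqrt_mul_sqrt_le_of_isGradLocal {A : Matrix (Fin d → ZMod M) (Fin d → ZMod M) ℝ}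
    {S : Finset (Fin d → ZMod M)} (hA : IsGradLocal A S) (hAs : A.IsSymm)
    {χ : (Fin d → ZMod M) → ℝ} (hχS : ∀ x ∈ S, χ x = 1) {p q C₀ c₀ L : ℝ} {m k : ℕ}
    (hχ : ∀ β : Fin d → ℕ, ∑ i, β i ≤ 2 * m → ∀ y, |iterDiff β χ y| ≤ p ^ (∑ i, β i))
    {s : Finset (Fin d → ℕ)} (hs : ∀ α ∈ s, ∑ i, α i ≤ m) (hc₀ : 0 ≤ c₀) (hL : 0 ≤ L)
    (hAB : (c₀ • derivForm L k s (fun _ => (1 : ℝ)) - A).PosSemidef)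
    {𝒞 : (Fin d → ZMod M) → ℝ} (hC : (Matrix.circulant 𝒞).PosSemidef)
    (h𝒞 : ∀ θ : Fin d → ℕ, ∑ i, θ i ≤ 2 * m → ∀ w, |iterDiff θ 𝒞 w| ≤ C₀ * q ^ (∑ i, θ i)) :
    (CFC.sqrt (Matrix.circulant 𝒞) * A * CFC.sqrt (Matrix.circulant 𝒞)).trace ≤
      c₀ * ((thicken m (univ.filter fun y => χ y ≠ 0)).card : ℝ) * C₀ *
        ∑ α ∈ s, L ^ (2 * k * (∑ i, α i - 1)) * (p + q) ^ (2 * ∑ i, α i) := by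
  set C := Matrix.circulant 𝒞 with hCdef
  set Q := Matrix.diagonal χ * C * Matrix.diagonal χ with hQ
  have hQpsd : Q.PosSemidef := posSemidef_diag_mul_mul_diag hC χ
  -- `tr(√C A √C) = tr(A C) = tr(DAD C) = tr(A Q) ≤ c₀ tr(M Q)`
  have h1 : (CFC.sqrt C * A * CFC.sqrt C).trace = (A * Q).trace := by
    rw [trace_sqrt_mul_sqrt_eq_trace_mul hC]
    conv_lhs => rw [← diag_mul_mul_diag_eq_of_isGradLocal hA hAs hχS]
    rw [Matrix.mul_assoc (Matrix.diagonal χ * A) (Matrix.diagonal χ) C,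
      Matrix.trace_mul_comm (Matrix.diagonal χ * A), ← Matrix.mul_assoc, Matrix.trace_mul_comm, hQ]
  have h2 : (A * Q).trace ≤ (c₀ • derivForm L k s (fun _ => (1 : ℝ)) * Q).trace :=
    trace_mul_le_trace_mul_of_posSemidef hAB hQpsd
  -- expand `tr(M Q)`
  have h3 : (c₀ • derivForm L k s (fun _ => (1 : ℝ)) * Q).trace =
      c₀ * ∑ α ∈ s, L ^ (2 * k * (∑ i, α i - 1)) *
        ∑ x, iterDiff α (fun y => iterDiff α (fun z => Q z y) x) x := by
    rw [Matrix.smul_mul, Matrix.trace_smul, smul_eq_mul, derivForm, Finset.sum_mul, Matrix.trace_sum]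
    congr 1
    refine Finset.sum_congr rfl fun α _ => ?_
    rw [Matrix.smul_mul, Matrix.trace_smul, smul_eq_mul, conjDiag, Matrix.diagonal_one, Matrix.mul_one,
      trace_transpose_mul_mul_eq_sum]
  -- the kernel of `Q`
  have hQapply : ∀ z y, Q z y = χ z * 𝒞 (z - y) * χ y := fun z y => by
    rw [hQ, Matrix.mul_assoc, Matrix.diagonal_mul, Matrix.mul_diagonal, hCdef, Matrix.circulant_apply,
      mul_assoc]
  set U := thicken m (univ.filter fun y => χ y ≠ 0) with hU
  -- per `α`: the sum over `x` of the diagonal terms is at most `#U · C₀ (p+q)^{2|α|}`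
  have hper : ∀ α ∈ s, L ^ (2 * k * (∑ i, α i - 1)) * ∑ x, iterDiff α (fun y => iterDiff α (fun z => Q z y) x) x ≤
      L ^ (2 * k * (∑ i, α i - 1)) * ((U.card : ℝ) * (C₀ * (p + q) ^ (2 * ∑ i, α i))) := by
    intro α hα
    refine mul_le_mul_of_nonneg_left ?_ (pow_nonneg hL _)
    have hterm : ∀ x, iterDiff α (fun y => iterDiff α (fun z => Q z y) x) x =
        iterDiff α (fun y => χ y * iterDiff α (fun z => χ z * 𝒞 (z - y)) x) x := by
      intro x
      congr 1; funext y
      have : (fun z => Q z y) = χ y • fun z => χ z * 𝒞 (z - y) := by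
        funext z; rw [hQapply, Pi.smul_apply, smul_eq_mul]; ring
      rw [this, iterDiff_smul, Pi.smul_apply, smul_eq_mul]
    simp_rw [hterm]
    rw [← Finset.sum_subset (Finset.subset_univ U) (fun x _ hxU =>
      iterDiff_iterDiff_kernel_eq_zero (𝒞 := 𝒞) (hs α hα) hxU)]
    calc ∑ x ∈ U, iterDiff α (fun y => χ y * iterDiff α (fun z => χ z * 𝒞 (z - y)) x) x
        ≤ ∑ x ∈ U, |iterDiff α (fun y => χ y * iterDiff α (fun z => χ z * 𝒞 (z - y)) x) x| :=
          Finset.sum_le_sum fun x _ => le_abs_self _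
      _ ≤ ∑ _x ∈ U, C₀ * (p + q) ^ (2 * ∑ i, α i) :=
          Finset.sum_le_sum fun x _ => abs_iterDiff_iterDiff_kernel_le hχ h𝒞 (hs α hα) x
      _ = (U.card : ℝ) * (C₀ * (p + q) ^ (2 * ∑ i, α i)) := by rw [Finset.sum_const, nsmul_eq_mul]
  rw [h1]
  refine h2.trans ?_
  rw [h3]
  calc c₀ * ∑ α ∈ s, L ^ (2 * k * (∑ i, α i - 1)) * ∑ x, iterDiff α (fun y => iterDiff α (fun z => Q z y) x) x
      ≤ c₀ * ∑ α ∈ s, L ^ (2 * k * (∑ i, α i - 1)) * ((U.card : ℝ) * (C₀ * (p + q) ^ (2 * ∑ i, α i))) :=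
        mul_le_mul_of_nonneg_left (Finset.sum_le_sum hper) hc₀
    _ = c₀ * (U.card : ℝ) * C₀ * ∑ α ∈ s, L ^ (2 * k * (∑ i, α i - 1)) * (p + q) ^ (2 * ∑ i, α i) := by
        rw [Finset.mul_sum, Finset.mul_sum]
        exact Finset.sum_congr rfl fun α _ => by ring

end Literature.MathematicalPhysics.StatisticalMechanics.GradientRG

end
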